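import Summits.BirchSwinnertonDyer.BirchSwinnertonDyer.Theorems.ByReductionTypeAtTwoAdditiveKatoFineConjAGenusDoor
import Summits.BirchSwinnertonDyer.BirchSwinnertonDyer.Theorems.ByReductionTypeAtTwoFineSelmerConjAAtTwoAdditivePotGoodMinkowskiDoor
import Summits.BirchSwinnertonDyer.BirchSwinnertonDyer.Theorems.ByReductionTypeAtTwoFineSelmerConjAAtTwoAdditivePotGoodClassNumberOneDoor
import Summits.BirchSwinnertonDyer.BirchSwinnertonDyer.Theorems.ByReductionTypeAtTwoFineSelmerConjAAtTwoAdditivePotGoodTwoLayerDoorFukudaRows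
import Literature.NumberTheory.NumberFields.CubicFieldOneRealPlace
import HarnessLib

/-!
# Route `ByReductionTypeAtTwo` (rung K4), crux C1″ `FineSelmerConjAAtTwoAdditivePotGood` (item stmt-BirchSwinnertonDyer-22615):
# THE GENUS DOOR IN THE CUBIC CURRENCY — (A)₂ with NO Lim fact for every `S₃`-cubic point field `ℚ(β)` with
# `disc < 0`, ONE prime above `2` and ODD class number; UNCONDITIONAL (A)₂ for `y² = x³ − x − 1`, `y² = x³ + x − 1`, `y² = x³ − 2`
# (a `--supports 22615` file; seat `bsd-2adic-k4-w1` GEN 8; pen RC-464 (2) «22615 door rows = k4-w1»; consumer of k4-w2's p723127)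

HONEST FRAMING (cell `bsd-2adic`, D-0036/D-0054/D-0152): THEOREMS ONLY (no definition, no named fact, no `sorry`). The doors of
§1 are PROVED OUTRIGHT — conditional on NOTHING from print: the only hypotheses are per-field KERNEL-decidable data of ONE cubic
number field (`disc < 0`, the splitting of `2`, the parity of `h`). §2 instantiates them with kernel certificates: statement (A) of
Coates–Sujatha at `p = 2` holds UNCONDITIONALLY for the three named curves. Closes nothing at the `∀`-level (C1″ 22615 stays
research-open on its residual, `…UniquePrimeDoor` §3 / RES₂ p692579); nothing booked; BSD is not proved by any of this.

WHY. Every earlier per-row stamp of this census (`conjA_two_<L> hLim2 …`, GEN 4–7) went through the UNIQUE-PRIME DOOR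
`fineSelmerDual_moduleFinite_two_of_unique_prime_pointField hLim2` — Iwasawa 1956 at the CUBIC carrier `ℚ(β)` (kernel) followed by
Lim 2017 Thm. 3.5 at `2` DOWNSTAIRS (`hLim2`, PRINT, at a field with a real place: the pen's RC-457 D-audit risk). k4-w2 GEN 9
replaced the second step by genus theory on the SEXTIC carrier `ℚ(β, √−1)` (`conjA_two_of_pointField_genus`, p723127: Chevalley's
ambiguous class number formula p722124 + ramification of `√−1` above `2` p722472 + Iwasawa 1956 + w2's unipotent-dévissage door
p718233), asking of the point field `E = ℚ̄^{Stab P}`: ONE real place, odd `h`, ONE prime above `2` with odd `e`. This file cashes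
that door in the census currency `E = ℚ(β)`, `β` a root of `X³ + pX² + qX + r`:

* §1 **`conjA_two_of_genus_adjoin_root`** — `W/ℚ` elliptic, `P ∈ W[2] ∖ 0` with `ℚ̄^{Stab P} = ℚ(β)`, `[ℚ(β):ℚ] = 3`,
  `disc(X³ + pX² + qX + r) < 0`, `2 ∤ #Cl(𝓞 ℚ(β))`, one prime of `ℚ(β)` above `2` ⟹ (A)₂ at `W` (`∃ γ D` currency), NO `hLim2`:
  «one real place» is `card_isReal_adjoin_eq_one_of_cubic_discr_neg` (this seat's Literature file `CubicFieldOneRealPlace`: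
  a real cubic of negative discriminant has ONE real root), «odd `e`» is GEN 5's `odd_ramificationIdx_of_existsUnique_two_mem`
  (`e f = 3`). Specialisations deciding the splitting of `2` by the kernel: **`conjA_two_of_genus_odd_pointField`** (`r` odd,
  `p + q` odd: `2` inert, `…InertDoor`), **`conjA_two_of_genus_eisenstein_pointField`** (`p, q, r` even, `4 ∤ r`: `2 = 𝔭³`,
  `…EisensteinDoor`), and the cubic-model forms **`conjA_two_cubicModel_of_genus_odd`** / **`…_of_genus_eisenstein`** for
  `W : y² = x³ + px² + qx + r` itself (`P = (β, 0)`, `…CubicRealization`). Remaining displayed datum: ONE parity bit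
  `2 ∤ #Cl(𝓞 ℚ(β))` (kernel-certified per row by GEN 6's class-number criteria).
* §2 **UNCONDITIONAL (A)₂** — zero hypotheses — for `y² = x³ − x − 1` (cubic field of discriminant `−23`), `y² = x³ + x − 1`
  (`−31`) and the Mordell curve `y² = x³ − 2` (`ℚ(∛2)`, `−108`): `conjA_two_cubicModel_disc_neg23'`, `…neg31'`, `…neg108'`
  (class number one by `…MinkowskiDoor`, kernel). These upgrade `conjA_two_cubicModel_disc_neg23/31/108 hLim2`.

The 12 census DOOR rows with `disc < 0` follow in `…GenusStamps{A,B,C}`; the two totally real door rows (`100560c1`, `301392cf1`,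
three real places) need the unit-signature (Horie) twin of p722124 and are NOT covered.

References: [CoatesSujatha2005] Conj. A, Thm. 3.4; [Greenberg2001IwasawaPastPresent] Prop. 2.1; [Lang1990] Ch. 13 §4 Lemma 4.1;
[NeukirchANT1999] I (8.2); [Cohen1993] §4.1.3, Prop. 4.8.11, App. B Table B.4; tree p718233, p722124, p722472, p723127.
-/

set_option autoImplicit false
-- sibling precedent (`…EisensteinDoor.lean`): the directory name repeats the summit name
set_option linter.dupNamespace false

noncomputable section

open scoped Classical IntermediateField NumberField

namespace Summit.BirchSwinnertonDyer.BirchSwinnertonDyer.Theorems.AddKatoTwo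

open WeierstrassCurve Field Polynomial IsDedekindDomain NumberField Literature.NumberTheory.EllipticCurves
  Literature.NumberTheory.GaloisRepresentations
  Literature.NumberTheory.IwasawaTheory Literature.NumberTheory.NumberFields
  Summit.BirchSwinnertonDyer.BirchSwinnertonDyer.Theorems.AlignedTransportAtTwoTorsionPointField
  Summit.BirchSwinnertonDyer.BirchSwinnertonDyer.Theses.ByReductionTypeAtTwo

/-! ## §1 The genus door in the cubic currency (NO Lim fact) -/

section Door

variable {p q r : ℤ}

/-- **THE GENUS DOOR IN THE CUBIC CURRENCY (β-root form) — NO Lim fact.** `W/ℚ` elliptic, `P ∈ W[2] ∖ 0` whose point field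
`ℚ̄^{Stab P}` is `ℚ(β)` for a root `β` of `X³ + pX² + qX + r` (`p q r : ℤ`) with `[ℚ(β) : ℚ] = 3` and NEGATIVE discriminant; if
`2 ∤ #Cl(𝓞 ℚ(β))` and `ℚ(β)` has exactly one prime above `2`, then statement (A) holds at `(W, 2)`: for every cyclotomic
`ℤ₂`-extension `κ` some fine Selmer dual datum of `W` over `ℚ_∞` is finitely generated over `ℤ₂`. KERNEL composition of k4-w2's
`conjA_two_of_pointField_genus` with «`disc < 0` ⟹ one real place» (`card_isReal_adjoin_eq_one_of_cubic_discr_neg`) and «odd degree,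
one prime ⟹ odd `e`» (`odd_ramificationIdx_of_existsUnique_two_mem`). [cite: CoatesSujatha2005, Conj. A and Thm. 3.4]
[cite: Greenberg2001IwasawaPastPresent, Prop. 2.1 p. 339] [cite: Cohen1993, Prop. 4.8.11] -/
theorem conjA_two_of_genus_adjoin_root (W : WeierstrassCurve ℚ) [W.IsElliptic] {P : geomTorsion W 2} (hP : P ≠ 0)
    {β : AlgebraicClosure ℚ} (hβ : aeval β (Cubic.toPoly ⟨1, (p : ℚ), q, r⟩) = 0)
    (h3 : Module.finrank ℚ (IntermediateField.adjoin ℚ {β}) = 3)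
    (hd : Cubic.discr ⟨1, (p : ℚ), q, r⟩ < 0)
    (hF : IntermediateField.fixedField (MulAction.stabilizer (absoluteGaloisGroup ℚ) P) = IntermediateField.adjoin ℚ {β})
    (hh : ¬ 2 ∣ Nat.card (ClassGroup (𝓞 (IntermediateField.adjoin ℚ {β}))))
    (hv : ∃! v : HeightOneSpectrum (𝓞 (IntermediateField.adjoin ℚ {β})),
      ((2 : ℕ) : 𝓞 (IntermediateField.adjoin ℚ {β})) ∈ v.asIdeal)
    (κ : ZpExtension ℚ 2) (hκ : κ.IsCyclotomic) :
    ∃ (γ : absoluteGaloisGroup ℚ) (D : W.FineSelmerDualData κ γ),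
      Module.Finite ℤ_[2] (RestrictScalars ℤ_[2] (IwasawaAlgebra 2) D.X) := by
  have hfm : (Cubic.toPoly ⟨1, (p : ℚ), q, r⟩).Monic := Cubic.monic_of_a_eq_one'
  have hβint : IsIntegral ℚ β := ⟨_, hfm, by rwa [← aeval_def]⟩
  haveI : FiniteDimensional ℚ (IntermediateField.adjoin ℚ {β}) := IntermediateField.adjoin.finiteDimensional hβint
  haveI : NumberField (IntermediateField.adjoin ℚ {β}) := NumberField.mk
  have hreal := card_isReal_adjoin_eq_one_of_cubic_discr_neg (θ := β) (P := ⟨1, (p : ℚ), q, r⟩) rfl hd hβ h3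
  have hodd : ∀ v : HeightOneSpectrum (𝓞 (IntermediateField.adjoin ℚ {β})),
      ((2 : ℕ) : 𝓞 (IntermediateField.adjoin ℚ {β})) ∈ v.asIdeal → Odd (v.asIdeal.ramificationIdx ℤ) :=
    fun v hv2 => odd_ramificationIdx_of_existsUnique_two_mem _ h3 hv v hv2
  have hh' : Odd (Nat.card (ClassGroup (𝓞 (IntermediateField.adjoin ℚ {β})))) :=
    Nat.odd_iff.mpr (Nat.two_dvd_ne_zero.mp hh)
  refine conjA_two_of_pointField_genus W hP ?_ ?_ ?_ ?_ κ hκ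
  · rw [hF]; exact hreal
  · rw [hF]; exact hh'
  · rw [hF]; exact hv
  · rw [hF]; exact hodd

/-- **The genus door, INERT block** (`r` odd, `p + q` odd ⟹ `2` inert in `ℚ(β)`, `[ℚ(β):ℚ] = 3`, both kernel — `…InertDoor`):
`ℚ̄^{Stab P} = ℚ(β)`, `disc < 0`, `2 ∤ #Cl(𝓞 ℚ(β))` ⟹ (A)₂ at `W`. NO Lim fact; the hLim2-free twin of
`fineSelmerDual_moduleFinite_two_of_odd_cubic_pointField`. [cite: CoatesSujatha2005, Conj. A and Thm. 3.4]
[cite: Greenberg2001IwasawaPastPresent, Prop. 2.1 p. 339] -/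
theorem conjA_two_of_genus_odd_pointField (W : WeierstrassCurve ℚ) [W.IsElliptic] {P : geomTorsion W 2} (hP : P ≠ 0)
    (hr : Odd r) (hpq : Odd (p + q)) {β : AlgebraicClosure ℚ} (hβ : aeval β (Cubic.toPoly ⟨1, (p : ℚ), q, r⟩) = 0)
    (hF : IntermediateField.fixedField (MulAction.stabilizer (absoluteGaloisGroup ℚ) P) = IntermediateField.adjoin ℚ {β})
    (hd : Cubic.discr ⟨1, (p : ℚ), q, r⟩ < 0)
    (hh : ¬ 2 ∣ Nat.card (ClassGroup (𝓞 (IntermediateField.adjoin ℚ {β}))))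
    (κ : ZpExtension ℚ 2) (hκ : κ.IsCyclotomic) :
    ∃ (γ : absoluteGaloisGroup ℚ) (D : W.FineSelmerDualData κ γ),
      Module.Finite ℤ_[2] (RestrictScalars ℤ_[2] (IwasawaAlgebra 2) D.X) :=
  conjA_two_of_genus_adjoin_root W hP hβ (finrank_adjoin_eq_three_of_odd hr hpq hβ) hd hF hh
    (existsUnique_two_mem_adjoin_of_odd hr hpq hβ) κ hκ

/-- **The genus door, EISENSTEIN block** (`p, q, r` even, `4 ∤ r` ⟹ `2 = 𝔭³` in `ℚ(β)`, `[ℚ(β):ℚ] = 3`, both kernel —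
`…EisensteinDoor`): `ℚ̄^{Stab P} = ℚ(β)`, `disc < 0`, `2 ∤ #Cl(𝓞 ℚ(β))` ⟹ (A)₂ at `W`. NO Lim fact; the hLim2-free twin of
`fineSelmerDual_moduleFinite_two_of_eisenstein_pointField`. [cite: CoatesSujatha2005, Conj. A and Thm. 3.4]
[cite: Greenberg2001IwasawaPastPresent, Prop. 2.1 p. 339] -/
theorem conjA_two_of_genus_eisenstein_pointField (W : WeierstrassCurve ℚ) [W.IsElliptic] {P : geomTorsion W 2} (hP : P ≠ 0)
    (hp : Even p) (hq : Even q) (hr : Even r) (hr4 : ¬ (4 : ℤ) ∣ r)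
    {β : AlgebraicClosure ℚ} (hβ : aeval β (Cubic.toPoly ⟨1, (p : ℚ), q, r⟩) = 0)
    (hF : IntermediateField.fixedField (MulAction.stabilizer (absoluteGaloisGroup ℚ) P) = IntermediateField.adjoin ℚ {β})
    (hd : Cubic.discr ⟨1, (p : ℚ), q, r⟩ < 0)
    (hh : ¬ 2 ∣ Nat.card (ClassGroup (𝓞 (IntermediateField.adjoin ℚ {β}))))
    (κ : ZpExtension ℚ 2) (hκ : κ.IsCyclotomic) :
    ∃ (γ : absoluteGaloisGroup ℚ) (D : W.FineSelmerDualData κ γ),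
      Module.Finite ℤ_[2] (RestrictScalars ℤ_[2] (IwasawaAlgebra 2) D.X) :=
  conjA_two_of_genus_adjoin_root W hP hβ (finrank_adjoin_eq_three_of_eisenstein hp hq hr hr4 hβ) hd hF hh
    (existsUnique_two_mem_adjoin_of_eisenstein hp hq hr hr4 hβ) κ hκ

/-- **The cubic model itself, INERT block**: for `W : y² = x³ + px² + qx + r` over `ℚ` (`r` odd, `p + q` odd), `β` a root, the
`2`-torsion point `(β, 0)` has point field `ℚ(β)` (`…CubicRealization`), so `disc < 0` and `2 ∤ #Cl(𝓞 ℚ(β))` ⟹ (A)₂ at `W` —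
NO Lim fact. [cite: CoatesSujatha2005, Conj. A and Thm. 3.4] [cite: Greenberg2001IwasawaPastPresent, Prop. 2.1 p. 339] -/
theorem conjA_two_cubicModel_of_genus_odd (hr : Odd r) (hpq : Odd (p + q))
    [(⟨0, (p : ℚ), 0, q, r⟩ : WeierstrassCurve ℚ).IsElliptic]
    {β : AlgebraicClosure ℚ} (hβ : aeval β (Cubic.toPoly ⟨1, (p : ℚ), q, r⟩) = 0)
    (hd : Cubic.discr ⟨1, (p : ℚ), q, r⟩ < 0)
    (hh : ¬ 2 ∣ Nat.card (ClassGroup (𝓞 (IntermediateField.adjoin ℚ {β}))))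
    (κ : ZpExtension ℚ 2) (hκ : κ.IsCyclotomic) :
    ∃ (γ : absoluteGaloisGroup ℚ) (D : (⟨0, (p : ℚ), 0, q, r⟩ : WeierstrassCurve ℚ).FineSelmerDualData κ γ),
      Module.Finite ℤ_[2] (RestrictScalars ℤ_[2] (IwasawaAlgebra 2) D.X) := by
  obtain ⟨P₀, hP₀, hP₀eq⟩ := exists_geomTorsion_two_eq_some_root (p : ℚ) q r hβ
  exact conjA_two_of_genus_odd_pointField _ hP₀ hr hpq hβ (fixedField_stabilizer_eq_adjoin_root (p : ℚ) q r hβ hP₀eq)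
    hd hh κ hκ

/-- **The cubic model itself, EISENSTEIN block**: for `W : y² = x³ + px² + qx + r` over `ℚ` (`p, q, r` even, `4 ∤ r`), `β` a root:
`disc < 0` and `2 ∤ #Cl(𝓞 ℚ(β))` ⟹ (A)₂ at `W` — NO Lim fact. [cite: CoatesSujatha2005, Conj. A and Thm. 3.4]
[cite: Greenberg2001IwasawaPastPresent, Prop. 2.1 p. 339] -/
theorem conjA_two_cubicModel_of_genus_eisenstein (hp : Even p) (hq : Even q) (hr : Even r) (hr4 : ¬ (4 : ℤ) ∣ r)
    [(⟨0, (p : ℚ), 0, q, r⟩ : WeierstrassCurve ℚ).IsElliptic]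
    {β : AlgebraicClosure ℚ} (hβ : aeval β (Cubic.toPoly ⟨1, (p : ℚ), q, r⟩) = 0)
    (hd : Cubic.discr ⟨1, (p : ℚ), q, r⟩ < 0)
    (hh : ¬ 2 ∣ Nat.card (ClassGroup (𝓞 (IntermediateField.adjoin ℚ {β}))))
    (κ : ZpExtension ℚ 2) (hκ : κ.IsCyclotomic) :
    ∃ (γ : absoluteGaloisGroup ℚ) (D : (⟨0, (p : ℚ), 0, q, r⟩ : WeierstrassCurve ℚ).FineSelmerDualData κ γ),
      Module.Finite ℤ_[2] (RestrictScalars ℤ_[2] (IwasawaAlgebra 2) D.X) := by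
  obtain ⟨P₀, hP₀, hP₀eq⟩ := exists_geomTorsion_two_eq_some_root (p : ℚ) q r hβ
  exact conjA_two_of_genus_eisenstein_pointField _ hP₀ hp hq hr hr4 hβ
    (fixedField_stabilizer_eq_adjoin_root (p : ℚ) q r hβ hP₀eq) hd hh κ hκ

end Door

/-! ## §2 UNCONDITIONAL (A)₂: three curves whose `2`-torsion cubic field is complex with class number one (kernel) -/

section Examples

/-- **Coates–Sujatha's statement (A) at `p = 2` holds UNCONDITIONALLY for `y² = x³ − x − 1`** (`2`-torsion point field the complex
cubic field of discriminant `−23`, `2` inert, `h = 1` — all KERNEL): for every cyclotomic `ℤ₂`-extension of `ℚ` the dual fine Selmer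
group of the curve over `ℚ_∞` is finitely generated over `ℤ₂` (`∃ γ D` currency). No named fact, no displayed datum. Upgrades
`conjA_two_cubicModel_disc_neg23 hLim2`. [cite: CoatesSujatha2005, Conj. A and Thm. 3.4] [cite: Cohen1993, App. B Table B.4 (d = −23)] -/
theorem conjA_two_cubicModel_disc_neg23' (κ : ZpExtension ℚ 2) (hκ : κ.IsCyclotomic) :
    haveI := isElliptic_cubicModel_disc_neg23
    ∃ (γ : absoluteGaloisGroup ℚ)
      (D : (⟨0, ((0 : ℤ) : ℚ), 0, ((-1 : ℤ) : ℚ), ((-1 : ℤ) : ℚ)⟩ : WeierstrassCurve ℚ).FineSelmerDualData κ γ),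
      Module.Finite ℤ_[2] (RestrictScalars ℤ_[2] (IwasawaAlgebra 2) D.X) := by
  haveI := isElliptic_cubicModel_disc_neg23
  obtain ⟨β, hβ⟩ : ∃ β : AlgebraicClosure ℚ, aeval β (Cubic.toPoly ⟨1, ((0 : ℤ) : ℚ), ((-1 : ℤ) : ℚ), ((-1 : ℤ) : ℚ)⟩) = 0 :=
    IsAlgClosed.exists_aeval_eq_zero _ _ (by rw [Cubic.degree_of_a_ne_zero one_ne_zero]; norm_num)
  exact conjA_two_cubicModel_of_genus_odd (p := 0) (q := -1) (r := -1) (by decide) (by decide) hβ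
    (by norm_num [Cubic.discr])
    (by rw [card_classGroup_adjoin_eq_one_of_odd_of_abs_discr_le (p := 0) (q := -1) (r := -1) (by decide) (by decide)
      (by simp only [Cubic.discr]; norm_num) hβ]; norm_num) κ hκ

/-- **Statement (A) at `p = 2` holds UNCONDITIONALLY for `y² = x³ + x − 1`** (complex cubic field of discriminant `−31`, `2` inert,
`h = 1`, kernel). Upgrades `conjA_two_cubicModel_disc_neg31 hLim2`. [cite: CoatesSujatha2005, Conj. A and Thm. 3.4]
[cite: Cohen1993, App. B Table B.4 (d = −31)] -/
theorem conjA_two_cubicModel_disc_neg31' (κ : ZpExtension ℚ 2) (hκ : κ.IsCyclotomic) :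
    haveI := isElliptic_cubicModel_disc_neg31
    ∃ (γ : absoluteGaloisGroup ℚ)
      (D : (⟨0, ((0 : ℤ) : ℚ), 0, ((1 : ℤ) : ℚ), ((-1 : ℤ) : ℚ)⟩ : WeierstrassCurve ℚ).FineSelmerDualData κ γ),
      Module.Finite ℤ_[2] (RestrictScalars ℤ_[2] (IwasawaAlgebra 2) D.X) := by
  haveI := isElliptic_cubicModel_disc_neg31
  obtain ⟨β, hβ⟩ : ∃ β : AlgebraicClosure ℚ, aeval β (Cubic.toPoly ⟨1, ((0 : ℤ) : ℚ), ((1 : ℤ) : ℚ), ((-1 : ℤ) : ℚ)⟩) = 0 :=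
    IsAlgClosed.exists_aeval_eq_zero _ _ (by rw [Cubic.degree_of_a_ne_zero one_ne_zero]; norm_num)
  exact conjA_two_cubicModel_of_genus_odd (p := 0) (q := 1) (r := -1) (by decide) (by decide) hβ
    (by norm_num [Cubic.discr])
    (by rw [card_classGroup_adjoin_eq_one_of_odd_of_abs_discr_le (p := 0) (q := 1) (r := -1) (by decide) (by decide)
      (by simp only [Cubic.discr]; norm_num) hβ]; norm_num) κ hκ

/-- **Statement (A) at `p = 2` holds UNCONDITIONALLY for the Mordell curve `y² = x³ − 2`** (`2`-torsion point field `ℚ(∛2)`,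
discriminant `−108`, `2 = 𝔭³`, `h = 1`, kernel). Upgrades `conjA_two_cubicModel_disc_neg108 hLim2`.
[cite: CoatesSujatha2005, Conj. A and Thm. 3.4] [cite: Cohen1993, App. B Table B.4 (d = −108)] -/
theorem conjA_two_cubicModel_disc_neg108' (κ : ZpExtension ℚ 2) (hκ : κ.IsCyclotomic) :
    haveI := isElliptic_cubicModel_disc_neg108
    ∃ (γ : absoluteGaloisGroup ℚ)
      (D : (⟨0, ((0 : ℤ) : ℚ), 0, ((0 : ℤ) : ℚ), ((-2 : ℤ) : ℚ)⟩ : WeierstrassCurve ℚ).FineSelmerDualData κ γ),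
      Module.Finite ℤ_[2] (RestrictScalars ℤ_[2] (IwasawaAlgebra 2) D.X) := by
  haveI := isElliptic_cubicModel_disc_neg108
  obtain ⟨β, hβ⟩ : ∃ β : AlgebraicClosure ℚ, aeval β (Cubic.toPoly ⟨1, ((0 : ℤ) : ℚ), ((0 : ℤ) : ℚ), ((-2 : ℤ) : ℚ)⟩) = 0 :=
    IsAlgClosed.exists_aeval_eq_zero _ _ (by rw [Cubic.degree_of_a_ne_zero one_ne_zero]; norm_num)
  exact conjA_two_cubicModel_of_genus_eisenstein (p := 0) (q := 0) (r := -2) (by decide) (by decide) (by decide) (by decide) hβ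
    (by norm_num [Cubic.discr])
    (by rw [card_classGroup_adjoin_eq_one_of_eisenstein_two_of_abs_discr_le (p := 0) (q := 0) (r := -2) (by decide)
      (by decide) (Or.inr rfl) (by simp only [Cubic.discr]; norm_num) hβ]; norm_num) κ hκ

end Examples

end Summit.BirchSwinnertonDyer.BirchSwinnertonDyer.Theorems.AddKatoTwo

end
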